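import Summits.AtomisticToContinuum.Crystallization.Theorems.HullExactificationCascadeHullGoodEverywhereDefs
import HarnessLib

/-!
# The bct witness lattice for crux `ZeroDefectDensity` — part 1: lattice and shells
# (route `HullExactificationCascade`, stmt-AtomisticToContinuum-12086; line `registered`/`birth`)

The birth line for the crux splits its defect set into the sites that are not RADIALLY TIGHT two
shells deep and the two-shell-tight sites whose shell is not `SiteGood`; its third stub
(`stub_orientationalOrder`) asserts that the latter have density zero in Lennard-Jones ground
states.  The cheapest conceivable proof of that stub would be the POINTWISE implication
"two-shell radially tight ⇒ `SiteGood`" at the route's constants (shell cutoff `13/10·d`, radial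
slack `21/20·d`, matching tolerance `1/20`).  These two files show that implication is FALSE, by an
explicit periodic witness: the body-centred-tetragonal stretch of the face-centred cubic lattice by
the factor `27/25` along a cube axis,
`S = {(25a, 25b, 27c) : a, b, c ∈ ℤ, a + b + c even} ⊆ ℝ³`.
Every site of `S` has nearest-neighbour distance `d = √1250`, exactly twelve other sites strictly
within `13/10·d` (at squared distances `1250` (×4) and `1354` (×8) `≤ (21/20)²·1250`), so every site
is radially tight (hence two-shell tight); but the shell of a site contains the pair
`(25,0,27), (25,0,-27)` (relative to the site) at rescaled distance `54/√1250 ≈ 1.5274`, which is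
more than `1/10` away from every pair distance of the cuboctahedron (`1, √2, √3, 2`) and of the
anticuboctahedron (`1, √2, √(8/3), √3, √(11/3), 2`); a `1/20`-matching after a linear isometry moves
pair distances by at most `1/10`, so no matching exists and the site is not `SiteGood`.

Consequence for the line: `stub_orientationalOrder` cannot be closed by geometry alone at these
constants — a few-percent homogeneous strain survives two (indeed all) shells of radial tightness —
so it is an ENERGETIC density statement about ground states, like `stub_radialShellOrder`.

This file (part 1): integer arithmetic of the labels, nearest-neighbour distance `√1250`, the
twelve-point shell and radial tightness at every site, summed up in the registered sub-goal
`bct_allSites_radialTight`.  Part 2 (`…BctWitness.lean`): the pair-distance dichotomy of the two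
patterns (squared distances `≤ 2` or `≥ 8/3`), no matching, the witness theorem.  No definitions and no notation are introduced: the lemmas are parametrised by the site map
`P : ℤ³ → ℝ³` and the site set `S`, pinned down by the hypotheses
`hP : ∀ w, P w = intVec (25 w₀, 25 w₁, 27 w₂)` and `hS : S = {P w : w₀ + w₁ + w₂ even}`.
-/

noncomputable section

namespace Summit.AtomisticToContinuum.Crystallization.Theorems.ZeroDefectDensityBirth

open Literature.Geometry.DiscreteGeometry

/-! ## Integer arithmetic of the labels -/

/-- A function on `Fin 3` is the vector of its three values. [folklore] -/
theorem eq_vec3 (w : Fin 3 → ℤ) : w = ![w 0, w 1, w 2] := by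
  ext i; fin_cases i <;> rfl

/-- Nonzero even-sum labels have squared site norm `625 w₀² + 625 w₁² + 729 w₂² ≥ 1250` (the
minimum, attained at `(±1, ±1, 0)`). [folklore] -/
theorem bctQ_ge (w : Fin 3 → ℤ) (hw : (w 0 + w 1 + w 2) % 2 = 0) (hne : w ≠ 0) :
    (1250 : ℤ) ≤ 625 * w 0 ^ 2 + 625 * w 1 ^ 2 + 729 * w 2 ^ 2 := by
  by_cases h0 : 2 ≤ |w 0|
  · nlinarith [sq_abs (w 0), sq_nonneg (w 1), sq_nonneg (w 2), abs_nonneg (w 0)]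
  by_cases h1 : 2 ≤ |w 1|
  · nlinarith [sq_abs (w 1), sq_nonneg (w 0), sq_nonneg (w 2), abs_nonneg (w 1)]
  by_cases h2 : 2 ≤ |w 2|
  · nlinarith [sq_abs (w 2), sq_nonneg (w 0), sq_nonneg (w 1), abs_nonneg (w 2)]
  push Not at h0 h1 h2
  rw [abs_lt] at h0 h1 h2
  have hne' : ¬ (w 0 = 0 ∧ w 1 = 0 ∧ w 2 = 0) := by
    rintro ⟨ha, hb, hc⟩
    exact hne (by rw [eq_vec3 w, ha, hb, hc]; ext i; fin_cases i <;> rfl)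
  generalize w 0 = a at *
  generalize w 1 = b at *
  generalize w 2 = c at *
  obtain ⟨ha1, ha2⟩ := h0
  obtain ⟨hb1, hb2⟩ := h1
  obtain ⟨hc1, hc2⟩ := h2
  interval_cases a <;> interval_cases b <;> interval_cases c <;> omega

/-- The even-sum nonzero labels of squared site norm `≤ 2112` (i.e. the sites strictly within
`13/10 · √1250` of the origin) are among the twelve fcc minimal vectors `fccInt`. [folklore] -/
theorem mem_fccInt_of_bctQ_le (w : Fin 3 → ℤ) (hw : (w 0 + w 1 + w 2) % 2 = 0) (hne : w ≠ 0)
    (hQ : 625 * w 0 ^ 2 + 625 * w 1 ^ 2 + 729 * w 2 ^ 2 ≤ (2112 : ℤ)) : w ∈ fccInt := by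
  have h0 : |w 0| < 2 := by
    by_contra h
    push Not at h
    nlinarith [sq_abs (w 0), sq_nonneg (w 1), sq_nonneg (w 2), abs_nonneg (w 0)]
  have h1 : |w 1| < 2 := by
    by_contra h
    push Not at h
    nlinarith [sq_abs (w 1), sq_nonneg (w 0), sq_nonneg (w 2), abs_nonneg (w 1)]
  have h2 : |w 2| < 2 := by
    by_contra h
    push Not at h
    nlinarith [sq_abs (w 2), sq_nonneg (w 0), sq_nonneg (w 1), abs_nonneg (w 2)]
  rw [abs_lt] at h0 h1 h2
  have hne' : ¬ (w 0 = 0 ∧ w 1 = 0 ∧ w 2 = 0) := by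
    rintro ⟨ha, hb, hc⟩
    exact hne (by rw [eq_vec3 w, ha, hb, hc]; ext i; fin_cases i <;> rfl)
  rw [eq_vec3 w]
  clear hQ
  generalize w 0 = a at *
  generalize w 1 = b at *
  generalize w 2 = c at *
  obtain ⟨ha1, ha2⟩ := h0
  obtain ⟨hb1, hb2⟩ := h1
  obtain ⟨hc1, hc2⟩ := h2
  interval_cases a <;> interval_cases b <;> interval_cases c <;> first | decide | omega

/-- The twelve fcc minimal vectors are even-sum, nonzero, and label sites of squared norm
`≤ 1354` (`1250` for `(±1,±1,0)`, `1354` for the eight others). [folklore] -/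
theorem fccInt_bct_facts : ∀ w ∈ fccInt, (w 0 + w 1 + w 2) % 2 = 0 ∧ w ≠ 0 ∧
    625 * w 0 ^ 2 + 625 * w 1 ^ 2 + 729 * w 2 ^ 2 ≤ (1354 : ℤ) := by
  decide

/-! ## The stretched lattice: membership, injectivity, distances

From here on `P : ℤ³ → ℝ³` is the site map and `S ⊆ ℝ³` the site set of the witness, fixed by
`hP : ∀ w, P w = intVec (25 w₀, 25 w₁, 27 w₂)` and `hS : S = {P w : w₀ + w₁ + w₂ even}`. -/

/-- Sites with even-sum labels belong to the witness set. [folklore] -/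
theorem bct_mem (P : (Fin 3 → ℤ) → EuclideanSpace ℝ (Fin 3)) {S : Set (EuclideanSpace ℝ (Fin 3))}
    (hS : S = {p | ∃ w : Fin 3 → ℤ, (w 0 + w 1 + w 2) % 2 = 0 ∧ P w = p})
    (w : Fin 3 → ℤ) (hw : (w 0 + w 1 + w 2) % 2 = 0) : P w ∈ S := by
  subst hS
  exact ⟨w, hw, rfl⟩

/-- Labels are determined by sites. [folklore] -/
theorem bct_label_eq {P : (Fin 3 → ℤ) → EuclideanSpace ℝ (Fin 3)}
    (hP : ∀ w, P w = intVec ![25 * w 0, 25 * w 1, 27 * w 2]) {v u : Fin 3 → ℤ}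
    (h : P v = P u) : v = u := by
  rw [hP, hP] at h
  have h' := intVec_injective h
  have h0 := congrFun h' 0
  have h1 := congrFun h' 1
  have h2 := congrFun h' 2
  simp only [Matrix.cons_val_zero, Matrix.cons_val_one, Matrix.cons_val] at h0 h1 h2
  rw [eq_vec3 v, eq_vec3 u]
  have e0 : v 0 = u 0 := by omega
  have e1 : v 1 = u 1 := by omega
  have e2 : v 2 = u 2 := by omega
  rw [e0, e1, e2]

/-- Distances between sites: `dist(P v, P u) = √(625 w₀² + 625 w₁² + 729 w₂²)`, `w = v - u`.
[folklore] -/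
theorem bct_dist {P : (Fin 3 → ℤ) → EuclideanSpace ℝ (Fin 3)}
    (hP : ∀ w, P w = intVec ![25 * w 0, 25 * w 1, 27 * w 2]) (v u w : Fin 3 → ℤ)
    (h : v - u = w) :
    dist (P v) (P u) = Real.sqrt ((625 * w 0 ^ 2 + 625 * w 1 ^ 2 + 729 * w 2 ^ 2 : ℤ) : ℝ) := by
  subst h
  rw [hP, hP, dist_eq_norm, intVec_sub, norm_intVec]
  congr 1
  simp only [sqNormInt, Pi.sub_apply, Matrix.cons_val_zero, Matrix.cons_val_one, Matrix.cons_val]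
  push_cast
  ring

/-- For an integer `Q ≥ 0`: `√Q < 13/10 · √1250 ↔ Q ≤ 2112` (`(13/10)² · 1250 = 2112.5`).
[folklore] -/
theorem sqrt_lt_shell_iff (Q : ℤ) (hQ : 0 ≤ Q) :
    Real.sqrt (Q : ℝ) < 13 / 10 * Real.sqrt 1250 ↔ Q ≤ 2112 := by
  have h13 : (13 / 10 : ℝ) * Real.sqrt 1250 = Real.sqrt ((13 / 10) ^ 2 * 1250) := by
    rw [Real.sqrt_mul (by norm_num), Real.sqrt_sq (by norm_num)]
  rw [h13, Real.sqrt_lt_sqrt_iff (by exact_mod_cast hQ)]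
  constructor
  · intro h
    have h' : (Q : ℝ) < 2113 := h.trans (by norm_num)
    have h'' : Q < 2113 := by exact_mod_cast h'
    omega
  · intro h
    have h' : (Q : ℝ) ≤ 2112 := by exact_mod_cast h
    exact h'.trans_lt (by norm_num)

/-- For an integer `Q ≤ 1354`: `√Q ≤ 21/20 · √1250` (`(21/20)² · 1250 = 1378.125`). [folklore] -/
theorem sqrt_le_slack (Q : ℤ) (hQ : Q ≤ 1354) :
    Real.sqrt (Q : ℝ) ≤ 21 / 20 * Real.sqrt 1250 := by
  have h21 : (21 / 20 : ℝ) * Real.sqrt 1250 = Real.sqrt ((21 / 20) ^ 2 * 1250) := by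
    rw [Real.sqrt_mul (by norm_num), Real.sqrt_sq (by norm_num)]
  rw [h21]
  apply Real.sqrt_le_sqrt
  have h' : (Q : ℝ) ≤ 1354 := by exact_mod_cast hQ
  exact h'.trans (by norm_num)

/-- **Nearest-neighbour distance.** Every site of the witness set has distance exactly `√1250`
to the rest of the set (attained at the label shift `(1,1,0)`). [folklore] -/
theorem bct_sInf {P : (Fin 3 → ℤ) → EuclideanSpace ℝ (Fin 3)}
    (hP : ∀ w, P w = intVec ![25 * w 0, 25 * w 1, 27 * w 2]) {S : Set (EuclideanSpace ℝ (Fin 3))}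
    (hS : S = {p | ∃ w : Fin 3 → ℤ, (w 0 + w 1 + w 2) % 2 = 0 ∧ P w = p})
    (u : Fin 3 → ℤ) (hu : (u 0 + u 1 + u 2) % 2 = 0) :
    sInf ((fun z => dist z (P u)) '' (S \ {P u})) = Real.sqrt 1250 := by
  apply IsLeast.csInf_eq
  constructor
  · refine ⟨P (u + ![1, 1, 0]), ⟨bct_mem P hS _ ?_, ?_⟩, ?_⟩
    · simp only [Pi.add_apply, Matrix.cons_val_zero, Matrix.cons_val_one, Matrix.cons_val]
      omega
    · intro h
      have h' := bct_label_eq hP (Set.mem_singleton_iff.1 h)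
      have := congrFun h' 0
      simp at this
    · show dist _ _ = _
      rw [bct_dist hP _ _ (![1, 1, 0]) (by simp)]
      congr 1
  · subst hS
    rintro _ ⟨z, ⟨⟨v, hv, rfl⟩, hne⟩, rfl⟩
    show Real.sqrt 1250 ≤ dist _ _
    rw [bct_dist hP v u (v - u) rfl]
    have hne' : v - u ≠ 0 := by
      intro h
      rw [sub_eq_zero] at h
      exact hne (by rw [h]; rfl)
    have hpar : ((v - u) 0 + (v - u) 1 + (v - u) 2) % 2 = 0 := by
      simp only [Pi.sub_apply]
      omega
    have := bctQ_ge (v - u) hpar hne'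
    have h' : (1250 : ℝ) ≤
        ((625 * (v - u) 0 ^ 2 + 625 * (v - u) 1 ^ 2 + 729 * (v - u) 2 ^ 2 : ℤ) : ℝ) := by
      exact_mod_cast this
    exact Real.sqrt_le_sqrt h'

/-- **The shell.** The sites other than `P u` strictly within `13/10 · √1250` of `P u` are exactly
the twelve sites `P (u + w)`, `w ∈ fccInt`. [folklore] -/
theorem bct_shell_eq {P : (Fin 3 → ℤ) → EuclideanSpace ℝ (Fin 3)}
    (hP : ∀ w, P w = intVec ![25 * w 0, 25 * w 1, 27 * w 2]) {S : Set (EuclideanSpace ℝ (Fin 3))}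
    (hS : S = {p | ∃ w : Fin 3 → ℤ, (w 0 + w 1 + w 2) % 2 = 0 ∧ P w = p})
    (u : Fin 3 → ℤ) (hu : (u 0 + u 1 + u 2) % 2 = 0) :
    {z : EuclideanSpace ℝ (Fin 3) | z ∈ S ∧ z ≠ P u ∧ dist z (P u) < 13 / 10 * Real.sqrt 1250} =
      ((fccInt.image fun w : Fin 3 → ℤ => P (u + w) : Finset (EuclideanSpace ℝ (Fin 3))) :
        Set (EuclideanSpace ℝ (Fin 3))) := by
  subst hS
  ext z
  simp only [Set.mem_setOf_eq, Finset.coe_image, Set.mem_image, Finset.mem_coe]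
  constructor
  · rintro ⟨⟨v, hv, rfl⟩, hne, hdist⟩
    have hne' : v - u ≠ 0 := by
      intro h
      rw [sub_eq_zero] at h
      exact hne (by rw [h])
    have hpar : ((v - u) 0 + (v - u) 1 + (v - u) 2) % 2 = 0 := by
      simp only [Pi.sub_apply]
      omega
    rw [bct_dist hP v u (v - u) rfl, sqrt_lt_shell_iff _ (by positivity)] at hdist
    refine ⟨v - u, mem_fccInt_of_bctQ_le (v - u) hpar hne' hdist, ?_⟩
    rw [add_sub_cancel]
  · rintro ⟨w, hw, rfl⟩
    obtain ⟨hpar, hne, hQ⟩ := fccInt_bct_facts w hw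
    refine ⟨⟨u + w, ?_, rfl⟩, ?_, ?_⟩
    · simp only [Pi.add_apply]
      omega
    · intro h
      have h' := bct_label_eq hP h
      exact hne (by simpa using h')
    · rw [bct_dist hP (u + w) u w (by simp), sqrt_lt_shell_iff _ (by positivity)]
      omega

/-- The twelve shell sites are distinct: the shell has `Nat.card = 12`. [folklore] -/
theorem bct_shell_card {P : (Fin 3 → ℤ) → EuclideanSpace ℝ (Fin 3)}
    (hP : ∀ w, P w = intVec ![25 * w 0, 25 * w 1, 27 * w 2]) (u : Fin 3 → ℤ) :
    Nat.card ↥((fccInt.image fun w : Fin 3 → ℤ => P (u + w) : Finset (EuclideanSpace ℝ (Fin 3))) :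
      Set (EuclideanSpace ℝ (Fin 3))) = 12 := by
  rw [Nat.card_coe_set_eq, Set.ncard_coe_finset, Finset.card_image_of_injective _ ?_, card_fccInt]
  intro w w' h
  have h' := bct_label_eq hP h
  simpa using h'

/-- **Radial tightness at every site** (the registered stubs' inlined predicate, verbatim shape, with
`Set.range (x N)` ↦ `S` and `x N i` ↦ `P u`): the strict `13/10·d`-shell of every site of the
witness set has exactly twelve sites, all within `21/20·d`. [folklore] -/
theorem bct_radialTight {P : (Fin 3 → ℤ) → EuclideanSpace ℝ (Fin 3)}
    (hP : ∀ w, P w = intVec ![25 * w 0, 25 * w 1, 27 * w 2]) {S : Set (EuclideanSpace ℝ (Fin 3))}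
    (hS : S = {p | ∃ w : Fin 3 → ℤ, (w 0 + w 1 + w 2) % 2 = 0 ∧ P w = p})
    (u : Fin 3 → ℤ) (hu : (u 0 + u 1 + u 2) % 2 = 0) :
    Nat.card ↥{w : EuclideanSpace ℝ (Fin 3) | w ∈ S ∧ w ≠ P u ∧
        dist w (P u) < 13 / 10 * sInf ((fun w => dist w (P u)) '' (S \ {P u}))} = 12 ∧
      ∀ w ∈ {w : EuclideanSpace ℝ (Fin 3) | w ∈ S ∧ w ≠ P u ∧
        dist w (P u) < 13 / 10 * sInf ((fun w => dist w (P u)) '' (S \ {P u}))},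
        dist w (P u) ≤ 21 / 20 * sInf ((fun w => dist w (P u)) '' (S \ {P u})) := by
  rw [bct_sInf hP hS u hu, bct_shell_eq hP hS u hu]
  refine ⟨bct_shell_card hP u, ?_⟩
  intro z hz
  obtain ⟨w, hw, rfl⟩ : ∃ w ∈ fccInt, P (u + w) = z := by simpa using hz
  obtain ⟨-, -, hQ⟩ := fccInt_bct_facts w hw
  rw [bct_dist hP (u + w) u w (by simp)]
  exact sqrt_le_slack _ hQ

/-- **All sites radially tight (registered sub-goal `bct_allSites_radialTight`).** There is a
nonempty point set `S ⊆ ℝ³` with all mutual distances `≥ √1250` (the `27/25` bct stretch of the fcc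
lattice) every point `y` of which is radially tight in the registered stubs' sense: the points of
`S ∖ {y}` strictly within `13/10 · d` of `y`, `d = dist(y, S ∖ {y})`, are exactly twelve and all lie
within `21/20 · d`.  Part 2 shows that no point of this `S` is `SiteGood`. [folklore] -/
theorem bct_allSites_radialTight : ∃ S : Set (EuclideanSpace ℝ (Fin 3)), S.Nonempty ∧ (∀ p ∈ S, ∀ q ∈ S, p ≠ q → Real.sqrt 1250 ≤ dist p q) ∧ ∀ y ∈ S, Nat.card ↥{w : EuclideanSpace ℝ (Fin 3) | w ∈ S ∧ w ≠ y ∧ dist w y < 13 / 10 * sInf ((fun w => dist w y) '' (S \ {y}))} = 12 ∧ ∀ w ∈ {w : EuclideanSpace ℝ (Fin 3) | w ∈ S ∧ w ≠ y ∧ dist w y < 13 / 10 * sInf ((fun w => dist w y) '' (S \ {y}))}, dist w y ≤ 21 / 20 * sInf ((fun w => dist w y) '' (S \ {y})) := by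
  have hP : ∀ w : Fin 3 → ℤ, (fun w : Fin 3 → ℤ => intVec ![25 * w 0, 25 * w 1, 27 * w 2]) w =
      intVec ![25 * w 0, 25 * w 1, 27 * w 2] := fun w => rfl
  have hS : {p : EuclideanSpace ℝ (Fin 3) | ∃ w : Fin 3 → ℤ, (w 0 + w 1 + w 2) % 2 = 0 ∧
      (fun w : Fin 3 → ℤ => intVec ![25 * w 0, 25 * w 1, 27 * w 2]) w = p} =
      {p | ∃ w : Fin 3 → ℤ, (w 0 + w 1 + w 2) % 2 = 0 ∧
        (fun w : Fin 3 → ℤ => intVec ![25 * w 0, 25 * w 1, 27 * w 2]) w = p} := rfl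
  refine ⟨_, ⟨_, bct_mem _ hS 0 (by simp)⟩, ?_, ?_⟩
  · rintro p ⟨v, hv, rfl⟩ q ⟨w, hw, rfl⟩ hne
    rw [bct_dist hP v w (v - w) rfl]
    have hne' : v - w ≠ 0 := by
      intro h
      rw [sub_eq_zero] at h
      exact hne (by rw [h])
    have hpar : ((v - w) 0 + (v - w) 1 + (v - w) 2) % 2 = 0 := by
      simp only [Pi.sub_apply]
      omega
    have := bctQ_ge (v - w) hpar hne'
    have h' : (1250 : ℝ) ≤
        ((625 * (v - w) 0 ^ 2 + 625 * (v - w) 1 ^ 2 + 729 * (v - w) 2 ^ 2 : ℤ) : ℝ) := by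
      exact_mod_cast this
    exact Real.sqrt_le_sqrt h'
  · rintro y ⟨u, hu, rfl⟩
    exact bct_radialTight hP hS u hu

end Summit.AtomisticToContinuum.Crystallization.Theorems.ZeroDefectDensityBirth

end
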